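import Summits.QuantumFields.YangMills.Theses.ComplexCouplingChannel
import Literature.Analysis.Complex.HarnackHalfPlane

/-!
# Crux-idea sketch — `flux-vacua-harnack-pinch` (crux `TubeZeroFreeChannel`, stmt-QuantumFields-18841)

Ideator planner-cruxidea-stmt-QuantumFields-18841-2-0 (round 1, k = 2), 2026-08-17.

Lens: negation.  LEVER: for a compact simple gauge group with `π₁(G) ≠ 0` (e.g. `SO(3) = PSU(2)`)
the PERIODIC `L³` transfer matrix has `|H²(T³; π₁G)|` near-degenerate flat ('t Hooft magnetic-flux)
vacua whose splitting `g_L(β) = ΔE_m(β, L) ~ L e^{-ρ(β) L²}` (confinement; Kovács–Tomboulis (c))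
or `~ e^{-M(β) L}` (ℤ₂-monopole world-line tunnelling, de Forcrand–Jahn) decays at a
β-DEPENDENT exponential rate.  Harnack's inequality for the holomorphic splitting `g_L` on a
zero-free disc forbids exactly this ("two-rate" ⇒ `Re g_L` must vanish inside every disc about
`β` for all large `L`), and loss of strict dominance inside the disc forces tube zeros there as
`t → ∞` (Beraha–Kahane–Weiss).  Hence the crux fails at such `(G, r)` at EVERY weak-coupling `β`.

Contents (sorry-free):
* `Zc`, `UniformZeroFreeOn`, `CruxBody`, `tubeZeroFreeChannel_iff` — the crux over named
  definitions (copied verbatim from the strategist's sketch; `Iff.rfl`);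
* `PinchedAt`, `PinchedAxis`, `not_tubeZeroFreeChannel_of_pinchedAxis` — typed obstruction + glue;
* FIRST LEMMA `exists_re_nonpos_of_twoRate` — the Harnack two-rate pinch (PROVED from the tree's
  `Complex.im_apply_ge_harnack`);
* `ZerosAtDominanceLoss` (analytic stub, multi-level BKW-lite, stated) and `FluxVacuaTwoRate`
  (physics stub, stated), with the glue `not_tubeZeroFreeChannel_of_fluxVacua` PROVED from them.
-/

set_option autoImplicit false

noncomputable section

namespace Summit.QuantumFields.YangMills.Cruxes.TubeZeroFreeChannel.FluxPinch

open scoped BigOperators Topology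
open MeasureTheory Filter Metric
open Literature.MathematicalPhysics.QuantumFieldTheory (LatticeRep IsCompactSimpleLieGroup
  haarProbability)
open Summit.QuantumFields.YangMills.Theses.ComplexCouplingChannel (TubeZeroFreeChannel)

section Defs

variable (G : Type) [Group G] [TopologicalSpace G] [IsTopologicalGroup G] [CompactSpace G]
  [MeasurableSpace G] [BorelSpace G]

/-- The complex-coupling Wilson partition function of the periodic box `a³ × t` in the
representation `r` — verbatim the `let Zc` of the route decl `TubeZeroFreeChannel`. -/
def Zc (r : LatticeRep G) (z : ℂ) (a t : ℕ) : ℂ :=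
  let St := Fin a × Fin a × Fin a × Fin t
  let sh : St → Fin 4 → St := fun x μ => ![(finRotate a x.1, x.2.1, x.2.2.1, x.2.2.2),
    (x.1, finRotate a x.2.1, x.2.2.1, x.2.2.2), (x.1, x.2.1, finRotate a x.2.2.1, x.2.2.2),
    (x.1, x.2.1, x.2.2.1, finRotate t x.2.2.2)] μ
  let pl : (St × Fin 4 → G) → St → Fin 4 → Fin 4 → G := fun U x μ ν =>
    U (x, μ) * U (sh x μ, ν) * (U (sh x ν, μ))⁻¹ * (U (x, ν))⁻¹
  ∫ U, Complex.exp (-(z * ((∑ x : St, ∑ q : {q : Fin 4 × Fin 4 // q.1 < q.2},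
    ((r.N : ℝ) - (r.ρ (pl U x q.1.1 q.1.2)).trace.re) : ℝ) : ℂ)))
    ∂(Measure.pi fun _ : St × Fin 4 => haarProbability G)

/-- Uniform tube zero-freeness on `D` (cross-section floor `L₀`, then a length floor `t₀(L)`). -/
def UniformZeroFreeOn (r : LatticeRep G) (D : Set ℂ) : Prop :=
  ∃ L₀ : ℕ, ∀ L : ℕ, L₀ ≤ L → ∃ t₀ : ℕ, ∀ t : ℕ, t₀ ≤ t → ∀ z ∈ D, Zc G r z L t ≠ 0

/-- The axis point `β` is PINCHED for `(G, r)`: no disc about `β` is uniformly zero-free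
(tube zeros come arbitrarily close to `β` for cofinally many cross-sections `L`, lengths `t`). -/
def PinchedAt (r : LatticeRep G) (β : ℝ) : Prop :=
  ∀ δ : ℝ, 0 < δ → ¬ UniformZeroFreeOn G r (ball (β : ℂ) δ)

/-- The weak-coupling axis is pinched cofinally. -/
def PinchedAxis (r : LatticeRep G) : Prop :=
  ∀ b : ℝ, ∃ β : ℝ, b ≤ β ∧ PinchedAt G r β

variable {G}

/-- Uniform zero-freeness passes to subsets. -/
theorem uniformZeroFreeOn_mono (r : LatticeRep G) {D₁ D₂ : Set ℂ} (h : D₁ ⊆ D₂)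
    (h₂ : UniformZeroFreeOn G r D₂) : UniformZeroFreeOn G r D₁ := by
  obtain ⟨L₀, hL₀⟩ := h₂
  refine ⟨L₀, fun L hL => ?_⟩
  obtain ⟨t₀, ht₀⟩ := hL₀ L hL
  exact ⟨t₀, fun t ht z hz => ht₀ t ht z (h hz)⟩

end Defs

/-- The crux over the named definitions. -/
def CruxBody : Prop :=
  ∀ (G : Type) [Group G] [TopologicalSpace G] [IsTopologicalGroup G] [CompactSpace G]
    [MeasurableSpace G] [BorelSpace G], IsCompactSimpleLieGroup G → ∀ r : LatticeRep G,
    ∃ β₁ : ℝ, ∀ β : ℝ, β₁ ≤ β → ∀ ρ : ℝ, 0 < ρ → ∃ D : Set ℂ, IsOpen D ∧ IsConnected D ∧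
      (β : ℂ) ∈ D ∧ (∃ x : ℝ, |x| < ρ ∧ (x : ℂ) ∈ D) ∧ UniformZeroFreeOn G r D

/-- The route decl IS `CruxBody`, definitionally. -/
theorem tubeZeroFreeChannel_iff : TubeZeroFreeChannel ↔ CruxBody := Iff.rfl

/-! ## Typed obstruction and its glue (proved) -/

/-- A cofinally pinched admissible `(G, r)` refutes the crux: the crux's open `D ∋ β` contains a
disc about `β`, which would be uniformly zero-free. -/
theorem not_tubeZeroFreeChannel_of_pinchedAxis (G : Type) [Group G] [TopologicalSpace G]
    [IsTopologicalGroup G] [CompactSpace G] [MeasurableSpace G] [BorelSpace G]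
    (hG : IsCompactSimpleLieGroup G) (r : LatticeRep G) (h : PinchedAxis G r) :
    ¬ TubeZeroFreeChannel := by
  intro hT
  rw [tubeZeroFreeChannel_iff] at hT
  obtain ⟨β₁, hβ₁⟩ := hT G hG r
  obtain ⟨β, hb, hP⟩ := h β₁
  obtain ⟨D, hDo, -, hβD, -, hU⟩ := hβ₁ β hb 1 one_pos
  obtain ⟨δ, hδ, hball⟩ := Metric.isOpen_iff.mp hDo _ hβD
  exact hP δ hδ (uniformZeroFreeOn_mono r hball hU)

/-! ## FIRST LEMMA — the Harnack two-rate pinch (proved)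

If holomorphic functions `g_L` on the disc `B(β, R)` have `Re g_L(β) > 0` but the ratio
`Re g_L(x) / Re g_L(β)` at a fixed real point `x` with `|x - β| < R/2` tends to `0` along `L`,
then `Re g_L` cannot stay positive on the disc for all large `L`: Harnack's inequality for the
half-plane-valued map `i·g_L` would give `Re g_L(x) ≥ Re g_L(β)/3`.  Applied to the splitting
`g_L = log(λ₀/λ₁)` of the two top transfer-matrix levels this is the "two exponential rates ⇒
equimodularity inside every disc" step of the card. -/
theorem exists_re_nonpos_of_twoRate {g : ℕ → ℂ → ℂ} {β x R : ℝ} (hR : 0 < R)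
    (hx : |x - β| < R / 2)
    (hd : ∀ᶠ L in atTop, DifferentiableOn ℂ (g L) (ball (β : ℂ) R))
    (hpos : ∀ᶠ L in atTop, 0 < (g L β).re)
    (hrate : Tendsto (fun L => (g L x).re / (g L β).re) atTop (𝓝 0)) :
    ∃ᶠ L in atTop, ∃ z ∈ ball (β : ℂ) R, (g L z).re ≤ 0 := by
  by_contra hcontra
  rw [Filter.not_frequently] at hcontra
  have hsmall : ∀ᶠ L in atTop, (g L x).re / (g L β).re < 1 / 3 :=
    hrate.eventually (gt_mem_nhds (by norm_num))
  obtain ⟨L, hL4⟩ := (((hd.and hpos).and hcontra).and hsmall).exists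
  obtain ⟨⟨⟨hdL, hposL⟩, hcL⟩, hsL⟩ := hL4
  -- positivity of `Re g_L` on the whole disc
  have hposall : ∀ z ∈ ball (β : ℂ) R, 0 < (g L z).re := by
    intro z hz
    by_contra hle
    exact hcL ⟨z, hz, not_lt.mp hle⟩
  -- Harnack for `Q = I * g L` (`im Q = re g`)
  set Q : ℂ → ℂ := fun z => Complex.I * g L z with hQ
  have hQd : DifferentiableOn ℂ Q (ball (β : ℂ) R) := hdL.const_mul Complex.I
  have hQim : ∀ z, (Q z).im = (g L z).re := by
    intro z; simp [hQ, Complex.mul_im]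
  have hQpos : ∀ z ∈ ball (β : ℂ) R, 0 < (Q z).im := fun z hz => by
    rw [hQim]; exact hposall z hz
  have hxball : (x : ℂ) ∈ ball (β : ℂ) R := by
    rw [Metric.mem_ball, dist_eq_norm, ← Complex.ofReal_sub, Complex.norm_real, Real.norm_eq_abs]
    linarith
  have hH := Complex.im_apply_ge_harnack hR hQd hQpos hxball
  rw [hQim, hQim] at hH
  -- the Harnack factor at distance `< R/2` is at least `1/3`
  have hdist : ‖(x : ℂ) - β‖ < R / 2 := by
    rw [← Complex.ofReal_sub, Complex.norm_real, Real.norm_eq_abs]; exact hx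
  have hfac : (1 : ℝ) / 3 ≤ (R - ‖(x : ℂ) - (β : ℂ)‖) / (R + ‖(x : ℂ) - (β : ℂ)‖) := by
    have hn : 0 ≤ ‖(x : ℂ) - (β : ℂ)‖ := norm_nonneg _
    rw [div_le_div_iff₀ (by norm_num) (by linarith)]
    linarith
  have hβpos : 0 < (g L (β : ℂ)).re := hposL
  have hge : (g L (β : ℂ)).re / 3 ≤ (g L (x : ℂ)).re := by
    calc (g L (β : ℂ)).re / 3 = (g L (β : ℂ)).re * (1 / 3) := by ring
      _ ≤ (g L (β : ℂ)).re * ((R - ‖(x : ℂ) - (β : ℂ)‖) / (R + ‖(x : ℂ) - (β : ℂ)‖)) :=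
          mul_le_mul_of_nonneg_left hfac hβpos.le
      _ ≤ (g L (x : ℂ)).re := hH
  have hratio : (1 : ℝ) / 3 ≤ (g L x).re / (g L β).re := by
    rw [le_div_iff₀ hβpos]
    linarith
  linarith

/-! ## The two stubs of the refutation line (stated) and their glue to `¬ crux` (proved) -/

/-- ANALYTIC STUB (BKW-lite, multi-level; Beraha–Kahane–Weiss 1978 / Sokal 2004 for exponential
sums, in the form the line needs; provable by the open-mapping theorem + Hurwitz/Rouché, size M–L,
NOT proved here).  If on a disc the tube partition functions at cross-section `L` are a dominated
`k`-level exponential sum `∑ⱼ nⱼ λⱼ(z)^t` (levels holomorphic and zero-free on the disc, positive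
integer multiplicities, everything else smaller by a factor `θ^t` against an envelope `Λ ≥ ‖λⱼ‖`,
no two levels with a ratio of constant modulus), level `0` is strictly dominant at the centre but
NOT throughout the disc, then the tubes have zeros in the disc for arbitrarily large lengths `t`
(the maximal-modulus index changes inside the disc, so two maximal levels are equimodular at some
point of it, where zeros accumulate). -/
def ZerosAtDominanceLoss : Prop :=
  ∀ (G : Type) [Group G] [TopologicalSpace G] [IsTopologicalGroup G] [CompactSpace G]
    [MeasurableSpace G] [BorelSpace G] (r : LatticeRep G) (L : ℕ) (β R : ℝ) (k : ℕ)
    (lam : Fin (k + 2) → ℂ → ℂ) (n : Fin (k + 2) → ℕ) (Λ : ℂ → ℝ) (C θ : ℝ),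
    0 < R → (∀ j, 0 < n j) → 0 ≤ C → 0 ≤ θ → θ < 1 →
    (∀ j, DifferentiableOn ℂ (lam j) (ball (β : ℂ) R)) →
    (∀ j, ∀ z ∈ ball (β : ℂ) R, lam j z ≠ 0 ∧ ‖lam j z‖ ≤ Λ z) →
    (∀ z ∈ ball (β : ℂ) R, ∃ j, ‖lam j z‖ = Λ z) →
    (∀ i j, i ≠ j → ¬ ∃ c : ℝ, ∀ z ∈ ball (β : ℂ) R, ‖lam i z‖ = c * ‖lam j z‖) →
    (∀ z ∈ ball (β : ℂ) R, ∀ t : ℕ, 1 ≤ t →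
      ‖Zc G r z L t - ∑ j, (n j : ℂ) * (lam j z) ^ t‖ ≤ C * (θ * Λ z) ^ t) →
    (∀ j, j ≠ 0 → ‖lam j (β : ℂ)‖ < ‖lam 0 (β : ℂ)‖) →
    (∃ z ∈ ball (β : ℂ) R, ∃ j, j ≠ 0 ∧ ‖lam 0 z‖ ≤ ‖lam j z‖) →
    ∀ t₀ : ℕ, ∃ t : ℕ, t₀ ≤ t ∧ ∃ z ∈ ball (β : ℂ) R, Zc G r z L t = 0

/-- PHYSICS STUB (near-degenerate 't Hooft-flux vacua with a two-rate splitting; intended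
instance `(SO(3), defining representation)`, more generally any compact simple `G` with
`π₁(G) ≠ 0` and any faithful `r`).  For SOME admissible `(G, r)`, cofinally in `β` and on every
small disc about `β`: for all large `L` the tube partition functions are a dominated multi-level
exponential sum (the vacuum `λ₀` and the `|H²(T³; π₁G)| - 1` flux vacua, then a gap `θ_L < 1`
with an `L`-dependent constant — the conclusion is per `L`, `t → ∞`),
and for one flux level `j₀` the splitting `g_L` (`λ₀ = λ_{j₀} e^{g_L}`, `Re g_L = ΔE`) has the
TWO-RATE property `Re g_L(x) / Re g_L(β) → 0` (`L → ∞`) at a real point `x` arbitrarily close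
to `β` — the typed form of `ΔE_m(β, L) ≍ L e^{-ρ(β)L²}` (confinement, Kovács–Tomboulis (c)) or
`≍ e^{-M(β)L}` (ℤ₂-monopole world-line tunnelling) with `ρ` (resp. `M`) strictly monotone. -/
def FluxVacuaTwoRate : Prop :=
  ∃ (G : Type) (_ : Group G) (_ : TopologicalSpace G) (_ : IsTopologicalGroup G)
    (_ : CompactSpace G) (_ : MeasurableSpace G) (_ : BorelSpace G),
    IsCompactSimpleLieGroup G ∧ ∃ r : LatticeRep G, ∀ b : ℝ, ∃ β : ℝ, b ≤ β ∧
      ∀ δ : ℝ, 0 < δ → ∃ (R x : ℝ) (k : ℕ) (n : Fin (k + 2) → ℕ) (j₀ : Fin (k + 2))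
        (lam : ℕ → Fin (k + 2) → ℂ → ℂ) (Λ : ℕ → ℂ → ℝ) (g : ℕ → ℂ → ℂ) (L₀ : ℕ),
        0 < R ∧ R ≤ δ ∧ |x - β| < R / 2 ∧ (∀ j, 0 < n j) ∧ j₀ ≠ 0 ∧
        (∀ L : ℕ, L₀ ≤ L →
          (∀ j, DifferentiableOn ℂ (lam L j) (ball (β : ℂ) R)) ∧
          (∀ j, ∀ z ∈ ball (β : ℂ) R, lam L j z ≠ 0 ∧ ‖lam L j z‖ ≤ Λ L z) ∧
          (∀ z ∈ ball (β : ℂ) R, ∃ j, ‖lam L j z‖ = Λ L z) ∧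
          (∀ i j, i ≠ j → ¬ ∃ c : ℝ, ∀ z ∈ ball (β : ℂ) R, ‖lam L i z‖ = c * ‖lam L j z‖) ∧
          (∃ C θ : ℝ, 0 ≤ C ∧ 0 ≤ θ ∧ θ < 1 ∧ ∀ z ∈ ball (β : ℂ) R, ∀ t : ℕ, 1 ≤ t →
            ‖Zc G r z L t - ∑ j, (n j : ℂ) * (lam L j z) ^ t‖ ≤ C * (θ * Λ L z) ^ t) ∧
          (∀ j, j ≠ 0 → ‖lam L j (β : ℂ)‖ < ‖lam L 0 (β : ℂ)‖) ∧
          DifferentiableOn ℂ (g L) (ball (β : ℂ) R) ∧ 0 < (g L (β : ℂ)).re ∧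
          (∀ z ∈ ball (β : ℂ) R, lam L 0 z = lam L j₀ z * Complex.exp (g L z))) ∧
        Tendsto (fun L => (g L x).re / (g L β).re) atTop (𝓝 0)

/-- GLUE (proved): the analytic stub and the physics stub refute the crux. -/
theorem not_tubeZeroFreeChannel_of_fluxVacua (hA : ZerosAtDominanceLoss)
    (hP : FluxVacuaTwoRate) : ¬ TubeZeroFreeChannel := by
  obtain ⟨G, _, _, _, _, _, _, hG, r, hr⟩ := hP
  refine not_tubeZeroFreeChannel_of_pinchedAxis G hG r fun b => ?_
  obtain ⟨β, hb, hβ⟩ := hr b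
  refine ⟨β, hb, fun δ hδ hU => ?_⟩
  obtain ⟨R, x, k, n, j₀, lam, Λ, g, L₀, hR, hRδ, hx, hn, hj₀, hL, hrate⟩ := hβ δ hδ
  -- Harnack two-rate: `Re g_L ≤ 0` somewhere in the disc, for cofinally many `L`
  have hd : ∀ᶠ L in atTop, DifferentiableOn ℂ (g L) (ball (β : ℂ) R) :=
    eventually_atTop.2 ⟨L₀, fun L hLL => (hL L hLL).2.2.2.2.2.2.1⟩
  have hpos : ∀ᶠ L in atTop, 0 < (g L β).re :=
    eventually_atTop.2 ⟨L₀, fun L hLL => (hL L hLL).2.2.2.2.2.2.2.1⟩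
  have hfreq := exists_re_nonpos_of_twoRate hR hx hd hpos hrate
  -- unpack the (supposed) uniform zero-freeness of the `δ`-disc
  obtain ⟨L₁, hL₁⟩ := hU
  obtain ⟨L, hLge, z₀, hz₀, hgz₀⟩ := (frequently_atTop.1 hfreq) (max L₀ L₁)
  have hLL₀ : L₀ ≤ L := le_trans (le_max_left _ _) hLge
  have hLL₁ : L₁ ≤ L := le_trans (le_max_right _ _) hLge
  obtain ⟨hdlam, hlam, henv, hnd, ⟨C, θ, hC, hθ, hθ1, hdom⟩, hstrict, -, -, hfac⟩ := hL L hLL₀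
  -- at `z₀` the vacuum level is no longer strictly dominant: `‖λ₀‖ = ‖λ_{j₀}‖ e^{Re g} ≤ ‖λ_{j₀}‖`
  have hloss : ‖lam L 0 z₀‖ ≤ ‖lam L j₀ z₀‖ := by
    rw [hfac z₀ hz₀, norm_mul, Complex.norm_exp]
    have h1 : Real.exp (g L z₀).re ≤ 1 := by
      rw [← Real.exp_zero]; exact Real.exp_le_exp.mpr hgz₀
    calc ‖lam L j₀ z₀‖ * Real.exp (g L z₀).re ≤ ‖lam L j₀ z₀‖ * 1 :=
          mul_le_mul_of_nonneg_left h1 (norm_nonneg _)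
      _ = ‖lam L j₀ z₀‖ := mul_one _
  obtain ⟨t₀, ht₀⟩ := hL₁ L hLL₁
  obtain ⟨t, htt, z, hz, hZ⟩ := hA G r L β R k (lam L) n (Λ L) C θ hR hn hC hθ hθ1 hdlam hlam
    henv hnd hdom hstrict ⟨z₀, hz₀, j₀, hj₀, hloss⟩ t₀
  exact ht₀ t htt z (ball_subset_ball hRδ hz) hZ

end Summit.QuantumFields.YangMills.Cruxes.TubeZeroFreeChannel.FluxPinch
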